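import Summits.BirchSwinnertonDyer.Rank1Residual.P2.KrizLiTwoFortyThreeCurve
import Summits.BirchSwinnertonDyer.Rank1Residual.X12.CubeSumSylvesterOddPart
import Literature.NumberTheory.EllipticCurves.ComplexMultiplicationTwistIsogenyProofs
import Literature.NumberTheory.EllipticCurves.RationalPointInfiniteOrderCriteria
import HarnessLib

/-!
# Cell `bsd-print-cf2` (D-0131 (2) PRINT TIER, leaf CornerF @ `p = 2`), prover p3 «cube sums» — the curve
# `4563b1` (the `ℚ`-isogeny class of the Sylvester cube-sum curve `x³ + y³ = 13`) in the SETTING of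
# Kriz–Li 2019 Thm 5.1 (2), every kernel-checkable hypothesis DISCHARGED

HONEST FRAMING. Companion of `P2/KrizLiSmallCMBase{Transport,}.lean` (the Kriz–Li door made base- and
field-generic: `BSD(W', 2)` BY NAME for every globally minimal `W'` `ℚ`-isogenous to a twist `W^{(d)}`,
`W^{(d·d_K)}` of a CM base `W` with `N(W) < 5000`, a point of infinite order, `E(ℚ)[2] = 0`, `c₂` odd, a
Heegner field `K` and a (★)-datum, `d ∈ 𝒩(W, K)`, `χ_d(−N) = 1`). The leaf
`Summit.BirchSwinnertonDyer.WAllCornerFTwo` is OPEN AS A CLASS; nothing class-wide is closed; no named fact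
is introduced; nothing is asserted beyond kernel theorems about ONE explicit curve. This file discharges in
the kernel every hypothesis on the BASE `W = 4563b1 = [0,0,1,0,42]` (`y² + y = x³ + 42`, i.e.
`Y² = X³ + 2⁴·13²` with `Y = 8y + 4`, `X = 4x`; `Δ = −3³·13⁴`, `j = 0`, CM by `ℤ[ζ₃]`, `2` INERT in `K_CM`,
good supersingular at `2`), EXCEPT the (★)-datum, which for this base is NOT in print (Kriz–Li Table 1
stops at `N ≤ … `, Rem 6.3 names only `243a1`) and is a CERTIFICATE (lit g2 DOSSIER §14.4, kit j282459,
SageMath: Heegner field `ℚ(√−23)`, generator `P₀ = (273/4, 4507/8)`, `v₂(3·log P₀) = 1`, Heegner index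
`1.00000?` ⇒ (★) holds; to be reproduced by ty3 or -ref before anything is booked): consumers DISPLAY it as
`P2.HasKrizLiStarDatum curve4563b1 (sqrtField (−23))` (currency LITERAL-by-name((★)-display)).

WHY THIS BASE (seat p3's sentence «cube sums … √−3-isogeny descent … Sylvester families»): `4563b1` is the
`ℚ`-rational `3`-isogeny image (the `√−3`-isogeny twisted down to `ℚ`, kernel `{O, (0, ±52)}` of
`Y² = X³ + 2704`) of the SYLVESTER CUBE-SUM CURVE `C₁₃ : x³ + y³ = 13` (`13 ≡ 4 (mod 9)`, `3` a non-cube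
mod `13`: rank one by Dasgupta–Voight / Hu–Shu–Yin; `13 = (7/3)³ + (2/3)³`): `isIsogenous_cubeSumCurve_thirteen`
(tree `cubeSumCurve 13 : y² = x³ − 432·13²`, `X12.Sylvester.sylvesterCurve 13`). So the generic door puts
`BSD(·, 2)` on the QUADRATIC-TWIST family `C₁₃^{(d)}`, `C₁₃^{(−23d)}` (`d ∈ 𝒩`) of a Sylvester curve — the
first cube-sum base other than `C₉ = 243a1` — granted the certificate; the CUBIC-twist family `{C_p}` itself
stays OPEN at `2` (Hu–Shu–Yin 2019 p. 2: "for ℓ = 2, 3 there are no results known").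

DISCHARGED IN THE KERNEL: elliptic, globally minimal; `E(ℚ)[2] = 0` (no affine `2`-torsion modulo the good
prime `7`: `4x³ = −169` has no root in `𝔽₇`); `N(E) ∣ 4563 = 3³·13²` (`< 5000`: Ogg `f₃ ≤ v₃(Δ) = 3`, tame
`f₁₃ ≤ 2`; Cremona `N = 4563`, not needed); good reduction at `2`, `c₂(E) = 1`; for any quadratic `K` with
`d_K = −23`: the Heegner hypothesis (`(−23/3) = (−23/13) = 1`) and `2` split; `1 ≤ rank_ℤ E(ℚ)` (the point
`(−14/9, 154/27) = P₀ + (0, 6)`, `3 ∣ 9`); the membership `d ∈ 𝒩` from explicit congruences; the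
`3`-isogeny with `C₁₃`.

References: [KrizLi2019] Thm 5.1 (2), Def 4.1, §6 Ex. 6.2, Table 1, Rem 6.3; [Cremona1997] Table 1 (4563b1);
[DasguptaVoight2018] Thm 1.2.1; [HuShuYin2019] Thm 1.3 and p. 2; [SilvermanAEC2009] VII.1 Rem 1.1, VII.3.1(b),
VII.3.4, X.5.4; [Silverman1994] IV.10.4, IV.11.1; [CremonaAlgorithms1997] §3.8–3.9 (the 3-isogeny);
[Marcus1977] Ch. 3 Thm 25; lit DOSSIER §14.4 (HOME run/shared/lean/pub/bsd-print-cf2/DOSSIER.md).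
-/

noncomputable section

open scoped Classical

open WeierstrassCurve NumberField Literature.NumberTheory.EllipticCurves
  Literature.NumberTheory.EllipticCurves.Rank1Residual
  Literature.NumberTheory.EllipticCurves.ModularForms
  Literature.NumberTheory.EllipticCurves.HuShuYin2019
  Literature.NumberTheory.EllipticCurves.Rank1Residual.X11RankOneCertificates
  Summit.BirchSwinnertonDyer.Rank1Residual
  Summit.BirchSwinnertonDyer.BirchSwinnertonDyer.Theorems.ConductorBoundOfBadPrimes

set_option autoImplicit false

namespace Summit.BirchSwinnertonDyer.Rank1Residual.P2

/-! ## §1 The curve `4563b1` and its `3`-isogeny with `x³ + y³ = 13` -/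

/-- **Cremona's `4563b1 = [0,0,1,0,42]`**: `E : y² + y = x³ + 42` (`Y² = X³ + 2704 = X³ + 2⁴·13²` after
`Y = 8y + 4`, `X = 4x`); `Δ = −771147 = −3³·13⁴`, `c₄ = 0` (`j = 0`, CM by `ℤ[ζ₃]`); torsion `ℤ/3`
(`(0, 6)`, `(0, −7)`), rank `1`, generator `(273/4, 4507/8)`. [cite: Cremona1997, Table 1 (curve 4563b1)] -/
def curve4563b1 : WeierstrassCurve ℚ := ⟨0, 0, 1, 0, 42⟩

/-- The integer model of `4563b1`. [cite: Cremona1997, Table 1 (curve 4563b1)] -/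
def curve4563b1Int : WeierstrassCurve ℤ := ⟨0, 0, 1, 0, 42⟩

/-- The integer model maps to the rational one. [folklore] -/
theorem curve4563b1Int_map : curve4563b1Int.map (Int.castRingHom ℚ) = curve4563b1 := by
  ext <;> simp [curve4563b1Int, curve4563b1, WeierstrassCurve.map]

/-- The integer model base-changes to the rational one. [folklore] -/
theorem curve4563b1Int_baseChange : curve4563b1Int.baseChange ℚ = curve4563b1 := by
  ext <;> simp [curve4563b1Int, curve4563b1, WeierstrassCurve.baseChange, WeierstrassCurve.map]

/-- `Δ(E) = −771147 = −3³·13⁴`. [folklore] -/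
theorem curve4563b1_Δ : curve4563b1.Δ = -771147 := by
  simp only [curve4563b1, WeierstrassCurve.Δ, WeierstrassCurve.b₂, WeierstrassCurve.b₄, WeierstrassCurve.b₆,
    WeierstrassCurve.b₈]
  norm_num

/-- `Δ` of the integer model is `−771147`. [folklore] -/
theorem curve4563b1Int_Δ : curve4563b1Int.Δ = -771147 := by
  simp only [curve4563b1Int, WeierstrassCurve.Δ, WeierstrassCurve.b₂, WeierstrassCurve.b₄, WeierstrassCurve.b₆,
    WeierstrassCurve.b₈]
  norm_num

/-- `c₄(E) = 0` (so `j(E) = 0`). [folklore] -/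
theorem curve4563b1_c₄ : curve4563b1.c₄ = 0 := by
  simp only [curve4563b1, WeierstrassCurve.c₄, WeierstrassCurve.b₂, WeierstrassCurve.b₄]
  norm_num

/-- `E` is an elliptic curve (`Δ ≠ 0`). [folklore] -/
instance isElliptic_curve4563b1 : curve4563b1.IsElliptic :=
  X11b.isElliptic_of_discOf_ne_zero 0 0 1 0 42 (by decide +kernel)

/-- **`E = [0,0,1,0,42]` is globally minimal** (`|Δ| = 3³·13⁴`: `q¹² ∤ Δ` at every prime).
[cite: SilvermanAEC2009, VII.1 Remark 1.1] -/
instance isGloballyMinimal_curve4563b1 : curve4563b1.IsGloballyMinimal :=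
  X11b.isGloballyMinimal_of_krausCriterion_support 0 0 1 0 42 [(3, 3, 3), (13, 2, 4)]
    (by intro t ht; simp only [List.mem_cons, List.not_mem_nil, or_false] at ht
        rcases ht with rfl | rfl <;> norm_num)
    (by decide +kernel) (by decide +kernel)

/-- `j(E) = 0`. [folklore] -/
theorem curve4563b1_j : curve4563b1.j = 0 := by
  rw [WeierstrassCurve.j, curve4563b1_c₄]
  simp

/-- **`E` has complex multiplication** (`j = 0`: CM by `ℤ[ζ₃]`). [cite: SilvermanAEC2009, Appendix C §11, Example 11.3.1] -/
theorem hasCM_curve4563b1 : curve4563b1.HasCM :=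
  hasCM_of_j_eq_zero _ curve4563b1_j

/-- **`2` is inert in the CM field of `E`** (`K_CM = ℚ(√−3)`). [cite: Cox2013, §5.B Prop. 5.16] -/
theorem cmInert_two_curve4563b1 : CMInert curve4563b1 2 :=
  (cmInert_two_iff_of_hasCM hasCM_curve4563b1).2 (Or.inl (by rw [curve4563b1_j]; simp [cmFieldDiscrOfJ]))

/-- The scaling `u = ½`, `t = −½` (`(x, y) ↦ (x/4, y/8 − ½)`): `Y = 8y + 4`, `X = 4x`. [folklore] -/
def cubeSumThirteenScale : VariableChange ℚ :=
  ⟨⟨(1 / 2 : ℚ), 2, by norm_num, by norm_num⟩, 0, 0, -(1 : ℚ) / 2⟩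

/-- `[0,0,1,0,42]` becomes `Y² = X³ + 2704 = X³ + 2⁴·13²` under `cubeSumThirteenScale`. [folklore] -/
theorem cubeSumThirteenScale_smul : cubeSumThirteenScale • curve4563b1 = ⟨0, 0, 0, 0, 2704⟩ := by
  ext <;> simp [cubeSumThirteenScale, curve4563b1, WeierstrassCurve.variableChange_a₁,
    WeierstrassCurve.variableChange_a₂, WeierstrassCurve.variableChange_a₃,
    WeierstrassCurve.variableChange_a₄, WeierstrassCurve.variableChange_a₆] <;> norm_num

/-- **`x³ + y³ = 13` is `ℚ`-ISOGENOUS to `4563b1`**: the cube-sum curve `C₁₃` is `y² = x³ − 432·13² =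
x³ − 27·2704` (tree `cubeSumCurve 13`), the codomain of the rational `3`-isogeny of `Y² = X³ + 2704` with
kernel `{O, (0, ±52)}` (Vélu; tree `isIsogenous_mk_a₆`), and `Y² = X³ + 2704 ≅ 4563b1`.
[cite: CremonaAlgorithms1997, §3.8 and §3.9 (p. 87)] [cite: DasguptaVoight2018, §1 (E_p, Thm. 1.2.1)] -/
theorem isIsogenous_cubeSumCurve_thirteen : IsIsogenous (cubeSumCurve 13) curve4563b1 := by
  have h13 : cubeSumCurve 13 = ⟨0, 0, 0, 0, -73008⟩ := by
    (ext <;> simp [cubeSumCurve]); norm_num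
  -- Vélu at `c = −73008`: `y² = x³ − 73008 ~ y² = x³ − 27·(−73008) = x³ + 2704·3⁶`
  have h1 : IsIsogenous (⟨0, 0, 0, 0, -73008⟩ : WeierstrassCurve ℚ) ⟨0, 0, 0, 0, -27 * (-73008)⟩ :=
    isIsogenous_mk_a₆ (by norm_num)
  -- rescale `u = 3`: `y² = x³ + 2704·3⁶ ≅ y² = x³ + 2704`
  have h2 : (⟨⟨3, 1 / 3, by norm_num, by norm_num⟩, 0, 0, 0⟩ : VariableChange ℚ) •
      (⟨0, 0, 0, 0, -27 * (-73008)⟩ : WeierstrassCurve ℚ) = ⟨0, 0, 0, 0, 2704⟩ := by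
    (ext <;> simp [WeierstrassCurve.variableChange_a₁, WeierstrassCurve.variableChange_a₂,
      WeierstrassCurve.variableChange_a₃, WeierstrassCurve.variableChange_a₄,
      WeierstrassCurve.variableChange_a₆]); norm_num
  rw [h13]
  exact (h1.trans' (isIsogenous_of_smul_eq h2)).trans' (isIsogenous_of_smul_eq' cubeSumThirteenScale_smul)

/-- **The tree's minimal model `X12.Sylvester.sylvesterCurve 13 = [0,0,13,0,−1183]` of `C₁₃` is
`ℚ`-isogenous to `4563b1`** (it is `ℚ`-isomorphic to `cubeSumCurve 13`, tree `sylvesterScale_smul`).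
[cite: CremonaAlgorithms1997, §3.8 and §3.9] -/
theorem isIsogenous_sylvesterCurve_thirteen : IsIsogenous (X12.Sylvester.sylvesterCurve 13) curve4563b1 :=
  (isIsogenous_of_smul_eq (X12.Sylvester.sylvesterScale_smul 13)).trans'
    (by exact_mod_cast isIsogenous_cubeSumCurve_thirteen)

/-! ## §2 `E(ℚ)[2] = 0`: no rational `2`-torsion (reduction modulo the good prime `7`) -/

/-- **`E(ℚ)[2] = 0` for `E = 4563b1`**: modulo the good prime `7` there is no affine `2`-torsion point
(`2γ + 1 = 0 ⇒ γ = 3`, then `β³ = 9 + 3 − 42·… `: `4β³ = −169` has no root in `𝔽₇` — the cubes of `𝔽₇` are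
`{0, ±1}` and `−169/4 = 5`). [cite: KrizLi2019, Thm. 5.1 hypothesis "E(ℚ)[2] = 0"] [cite: SilvermanAEC2009, Prop. VII.3.1(b)] -/
theorem twoTorsion_curve4563b1 : ∀ Q : curve4563b1.toAffine.Point, 2 • Q = 0 → Q = 0 := by
  rw [← curve4563b1Int_map]
  haveI : Fact (Nat.Prime 7) := ⟨by norm_num⟩
  have hΔ : ¬ ((7 : ℕ) : ℤ) ∣ curve4563b1Int.Δ := by rw [curve4563b1Int_Δ]; norm_num
  have hB : twoTorsionNoneB curve4563b1Int 7 = true := by decide +kernel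
  exact fun Q hQ => twoTorsion_eq_zero_of_twoTorsionNoneB curve4563b1Int 7 hΔ (by norm_num) hB Q hQ

/-! ## §3 The conductor: `N_E ∣ 4563 = 3³·13²` -/

/-- **`N(E) ∣ 4563 = 3³·13²` — IN THE KERNEL** (Ogg's `f₃ ≤ v₃(Δ_min) = 3`; tame `f₁₃ ≤ 2`; Cremona:
`N = 4563` exactly, not needed). [cite: Silverman1994, IV.10.4 and IV.11.1] [cite: Cremona1997, Table 1 (4563b1)] -/
theorem conductorNorm_curve4563b1_dvd : curve4563b1.conductorNorm ℤ ∣ 4563 :=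
  conductorNorm_dvd_of_localBounds 0 0 1 0 42 curve4563b1 rfl [(3, 3), (13, 4)]
    (by intro t ht; simp only [List.mem_cons, List.not_mem_nil, or_false] at ht
        rcases ht with rfl | rfl <;> norm_num)
    (by decide +kernel) (by norm_num) (by decide +kernel)

/-- `N(E) < 5000` (so Creutz–Miller / Miller–Stoll reach the base). [folklore] -/
theorem conductorNorm_curve4563b1_lt : curve4563b1.conductorNorm ℤ < 5000 :=
  lt_of_le_of_lt (Nat.le_of_dvd (by norm_num) conductorNorm_curve4563b1_dvd) (by norm_num)

/-- `N(E) ≠ 0`. [folklore] -/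
instance neZero_conductorNorm_curve4563b1 : NeZero (curve4563b1.conductorNorm ℤ) :=
  ⟨(curve4563b1.conductorNorm_pos_holds).ne'⟩

/-- A prime `ℓ ∉ {2, 3, 13}` does not divide `2N(E)` (`2N(E) ∣ 2·3³·13²`). [folklore] -/
theorem not_dvd_two_mul_conductorNorm_curve4563b1 {ℓ : ℕ} (hℓ : ℓ.Prime) (h2 : ℓ ≠ 2) (h3 : ℓ ≠ 3)
    (h13 : ℓ ≠ 13) : ¬ ℓ ∣ 2 * curve4563b1.conductorNorm ℤ := by
  intro h
  have h' : ℓ ∣ 2 * (3 ^ 3 * 13 ^ 2) := h.trans (mul_dvd_mul_left 2 (by simpa using conductorNorm_curve4563b1_dvd))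
  rcases (Nat.Prime.dvd_mul hℓ).mp h' with h | h
  · exact h2 ((Nat.prime_dvd_prime_iff_eq hℓ Nat.prime_two).mp h)
  · rcases (Nat.Prime.dvd_mul hℓ).mp h with h | h
    · exact h3 ((Nat.prime_dvd_prime_iff_eq hℓ Nat.prime_three).mp (hℓ.dvd_of_dvd_pow h))
    · exact h13 ((Nat.prime_dvd_prime_iff_eq hℓ (by norm_num)).mp (hℓ.dvd_of_dvd_pow h))

/-! ## §4 At the prime `2`: good (supersingular) reduction, `c₂(E) = 1` -/

/-- **`E` has good reduction at `2`** (`2 ∤ Δ`). [cite: SilvermanAEC2009, VII.5 Prop. 5.1(a)] -/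
theorem hasGoodReductionAtPrime_two_curve4563b1 :
    haveI : Fact (2 : ℕ).Prime := ⟨Nat.prime_two⟩
    curve4563b1.HasGoodReductionAtPrime 2 := by
  haveI : Fact (2 : ℕ).Prime := ⟨Nat.prime_two⟩
  haveI : (curve4563b1Int.baseChange ℚ).IsElliptic := by rw [curve4563b1Int_baseChange]; infer_instance
  have h := BurungaleSkinner2023.hasGoodReductionAtPrime_baseChange_int_of_not_dvd curve4563b1Int (p := 2)
    (by rw [curve4563b1Int_Δ]; norm_num)
  rwa [curve4563b1Int_baseChange] at h

/-- **`c₂(E) = 1`** (good reduction at `2`). [cite: SilvermanAEC2009, VII.2 (remark after Prop. 2.1)] -/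
theorem localTamagawaNumber_two_curve4563b1 :
    haveI : Fact (2 : ℕ).Prime := ⟨Nat.prime_two⟩
    (curve4563b1.baseChange ℚ_[2]).localTamagawaNumber ℤ_[2] = 1 :=
  localTamagawaNumber_padic_eq_one_of_good_holds curve4563b1 2 hasGoodReductionAtPrime_two_curve4563b1

/-- **`c₂(E)` is odd.** [cite: KrizLi2019, Thm. 5.1 hypothesis "c₂(E) odd"] -/
theorem odd_localTamagawaNumber_two_curve4563b1 :
    haveI : Fact (2 : ℕ).Prime := ⟨Nat.prime_two⟩
    Odd ((curve4563b1.baseChange ℚ_[2]).localTamagawaNumber ℤ_[2]) := by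
  rw [localTamagawaNumber_two_curve4563b1]; exact odd_one

/-- **Kriz–Li's Manin clause is vacuous for `E = 4563b1`** (good reduction at `2`).
[cite: KrizLi2019, Thm. 5.1 hypothesis "Manin constant odd if additive at 2"] -/
theorem maninClause_curve4563b1 (Dt : ModularParametrizationData curve4563b1 (curve4563b1.conductorNorm ℤ)) :
    haveI : Fact (2 : ℕ).Prime := ⟨Nat.prime_two⟩
    ¬ curve4563b1.HasGoodReductionAtPrime 2 → ¬ curve4563b1.HasMultiplicativeReductionAtPrime 2 → Odd Dt.c :=
  fun h _ => absurd hasGoodReductionAtPrime_two_curve4563b1 h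

/-! ## §5 The Heegner field `K = ℚ(√−23)`: `3` and `13` split -/

/-- **The Heegner hypothesis of Thm 5.1 for `(4563b1, K)`, `d_K = −23`**: every prime of `N(E) ∣ 3³·13²`
splits in `K` (`(−23/3) = 1`, `(−23/13) = (3/13) = 1`). [cite: KrizLi2019, Thm. 5.1 hypothesis "Heegner hypothesis for N"]
[cite: Marcus1977, Ch. 3 Thm. 25] -/
theorem satisfiesHeegnerHypothesis_curve4563b1 {K : Type} [Field K] [NumberField K]
    (h2 : Module.finrank ℚ K = 2) (hdK : NumberField.discr K = -23) :
    SatisfiesHeegnerHypothesis (curve4563b1.conductorNorm ℤ) K := by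
  have h : SatisfiesHeegnerHypothesis (3 ^ 3 * 13 ^ 2) K := by
    rw [satisfiesHeegnerHypothesis_iff_kronecker _ K h2, hdK]
    intro q hq hqN
    rcases (Nat.Prime.dvd_mul hq).mp hqN with h | h
    · obtain rfl := (Nat.prime_dvd_prime_iff_eq hq Nat.prime_three).mp (hq.dvd_of_dvd_pow h)
      exact ⟨fun h => absurd h (by norm_num), fun _ => by norm_num⟩
    · obtain rfl := (Nat.prime_dvd_prime_iff_eq hq (by norm_num)).mp (hq.dvd_of_dvd_pow h)
      exact ⟨fun h => absurd h (by norm_num), fun _ => by norm_num⟩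
  exact h.of_dvd (by simpa using conductorNorm_curve4563b1_dvd)

/-! ## §6 `1 ≤ rank_ℤ E(ℚ)`: a rational point of infinite order -/

/-- **`1 ≤ rank_ℤ 4563b1(ℚ)` IN THE KERNEL**: the rational point `(−14/9, 154/27)` (`= (273/4, 4507/8) + (0, 6)`,
generator plus `3`-torsion) has `3 ∣ 9`, so it has infinite order (Silverman VII.3.4, tree
`one_le_mordellWeilRank_of_dvd_den`). [cite: SilvermanAEC2009, VII.3.4 and Thm. VIII.6.7] [cite: Cremona1997, Table 1 (4563b1: r = 1)] -/
theorem one_le_mordellWeilRank_curve4563b1 : 1 ≤ curve4563b1.mordellWeilRank :=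
  one_le_mordellWeilRank_of_dvd_den curve4563b1 3 le_rfl (x := -14 / 9) (y := 154 / 27)
    (WeierstrassCurve.Affine.equation_iff_nonsingular.mp (by
      rw [WeierstrassCurve.Affine.equation_iff]; norm_num [curve4563b1]))
    (by norm_num)

/-! ## §7 The index set `𝒩` of Kriz–Li Def 4.1 for `(4563b1, ℚ(√−23))`, from explicit congruences -/

/-- **An EXPLICIT sufficient condition for `ℓ ∈ 𝒮`** (Def 4.1 at `E = 4563b1`, `K = ℚ(√−23)`): `ℓ` prime,
`ℓ ∉ {2, 3, 13}` (`⟹ ℓ ∤ 2N`), `(−23/ℓ) = 1` (`ℓ` splits in `K`) and `a_ℓ(E)` odd (Frobenius of order `3`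
on `E[2]`; lit §14.4: `𝒮 = {31, 127, 151, 163, 193, 211, 271, 307, 397, 409, 439, 487, …}`).
[cite: KrizLi2019, Def. 4.1 (FMS) = arXiv Def. 3.1] -/
def IsKrizLiPrime4563 (ℓ : ℕ) : Prop :=
  ℓ.Prime ∧ ℓ ≠ 2 ∧ ℓ ≠ 3 ∧ ℓ ≠ 13 ∧ jacobiSym (-23) ℓ = 1 ∧ Odd (curve4563b1.frobeniusTrace ℓ)

/-- **`ℓ ∈ 𝒮`** for such `ℓ`, in any quadratic `K` with `d_K = −23`. [cite: KrizLi2019, Def. 4.1 (FMS)] -/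
theorem inS_curve4563b1 {K : Type} [Field K] [NumberField K] (h2 : Module.finrank ℚ K = 2)
    (hdK : NumberField.discr K = -23) {ℓ : ℕ} (h : IsKrizLiPrime4563 ℓ) : KrizLi2019.InS curve4563b1 K ℓ :=
  ⟨h.1, not_dvd_two_mul_conductorNorm_curve4563b1 h.1 h.2.1 h.2.2.1 h.2.2.2.1,
    ncard_primesOver_eq_two_of_discr_eq h2 hdK h.1 h.2.1 h.2.2.2.2.1, h.2.2.2.2.2⟩

/-- **`d ∈ 𝒩`** (`d ≡ 1 (mod 4)`, `|d|` a square-free product of primes in `𝒮`) from the explicit conditions,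
in any quadratic `K` with `d_K = −23`. [cite: KrizLi2019, Def. 4.1 (FMS)] -/
theorem inN_curve4563b1 {K : Type} [Field K] [NumberField K] (h2 : Module.finrank ℚ K = 2)
    (hdK : NumberField.discr K = -23) {d : ℤ} (hd4 : d % 4 = 1) (hsq : Squarefree d.natAbs)
    (hprimes : ∀ ℓ : ℕ, ℓ.Prime → ℓ ∣ d.natAbs → IsKrizLiPrime4563 ℓ) : KrizLi2019.InN curve4563b1 K d :=
  ⟨hd4, hsq, fun ℓ hℓ hℓd => inS_curve4563b1 h2 hdK (hprimes ℓ hℓ hℓd)⟩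

/-- **The sign condition `χ_d(−N) = 1` for POSITIVE `d ≡ 1 (mod 12)` with `(d/13) = 1`**, whatever the exact
conductor `N(E) ∣ 3³·13²` is: `sgn(d)·(N/d) = (3/d)^a (13/d)^b = (d/3)^a (d/13)^b = 1`.
[cite: KrizLi2019, Thm. 5.1 (2) condition "χ_d(−N) = 1"] -/
theorem sign_mul_jacobiSym_conductorNorm_curve4563b1 {d : ℤ} (hd0 : 0 < d) (hd12 : d % 12 = 1)
    (hd13 : jacobiSym d 13 = 1) : Int.sign d * jacobiSym (curve4563b1.conductorNorm ℤ) d.natAbs = 1 := by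
  rw [Int.sign_eq_one_of_pos hd0, one_mul]
  have hn : (d.natAbs : ℤ) = d := Int.natAbs_of_nonneg hd0.le
  have hn4 : d.natAbs % 4 = 1 := by omega
  have h3 : jacobiSym 3 d.natAbs = 1 := by
    have hn3 : (d.natAbs : ℤ) % ((3 : ℕ) : ℤ) = 1 % ((3 : ℕ) : ℤ) := by
      change (d.natAbs : ℤ) % 3 = 1 % 3
      omega
    have hrec := jacobiSym.quadratic_reciprocity_one_mod_four' (a := 3) (b := d.natAbs) (by decide) hn4
    rw [Nat.cast_ofNat] at hrec
    rw [hrec, jacobiSym.mod_left, hn3, ← jacobiSym.mod_left, jacobiSym.one_left]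
  have h13 : jacobiSym 13 d.natAbs = 1 := by
    have hrec := jacobiSym.quadratic_reciprocity_one_mod_four' (a := 13) (b := d.natAbs) (by decide) hn4
    rw [Nat.cast_ofNat] at hrec
    rw [hrec, hn]
    exact_mod_cast hd13
  obtain ⟨y, z, hy, hz, hyz⟩ := Nat.dvd_mul.1 (show curve4563b1.conductorNorm ℤ ∣ 3 ^ 3 * 13 ^ 2 by
    simpa using conductorNorm_curve4563b1_dvd)
  obtain ⟨i, -, rfl⟩ := (Nat.dvd_prime_pow Nat.prime_three).1 hy
  obtain ⟨k, -, rfl⟩ := (Nat.dvd_prime_pow (by norm_num : Nat.Prime 13)).1 hz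
  rw [← hyz, Nat.cast_mul, jacobiSym.mul_left, Nat.cast_pow, Nat.cast_pow, jacobiSym.pow_left,
    jacobiSym.pow_left, Nat.cast_ofNat, Nat.cast_ofNat, h3, h13, one_pow, one_pow, one_mul]

end Summit.BirchSwinnertonDyer.Rank1Residual.P2

end
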